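import Literature.MathematicalPhysics.QuantumLattice.PlaquetteWeightFreeEnergy
import HarnessLib

/-!
# The torus pressure of a continuous positive plaquette weight: thermodynamic limit

Sequel of `PlaquetteWeightFreeEnergy` (the box decomposition of the torus partition function
`Z_L(v) = ∫ ∏_{q} v(U_q) ∏_{e} dHaar(U_e)` of the pure plaquette lattice gauge theory with a
general single-plaquette weight `v` on the discrete torus `(ℤ/Lℤ)^d`). The main theorem
`tendsto_torusPressure_of_continuous_pos`: for a compact second-countable group `G` with a Borel
σ-algebra, every `d` and every continuous `v : G → ℝ` with `0 < v`, the pressure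
`(L+1)^{-d} log Z_{L+1}(v)` converges as `L → ∞` along *all* torus sides. This generalises
`FreeEnergy.exists_tendsto_torusLogPartition` of `LatticeGaugeDLRFreeEnergyProofs` (the Wilson
weight `v = exp(-β (N - Re tr ρ))`) and its proof is the same endgame (Friedli–Velenik, Thm. 3.6):
by compactness `e^{-K} ≤ v ≤ e^{K}` (`PlaquetteWeightFreeEnergy.exists_exp_neg_le_le_exp`);
dividing the sub-box estimate `PlaquetteWeightFreeEnergy.abs_log_torusZ_sub_le`,
`|log Z_L − q^d log Z(A_m)| ≤ K · #planes · (L^d − q^d (m−1)^d)` (`q = ⌊L/m⌋`), by `L^d` and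
letting `L → ∞` (`q/L → 1/m`, `FreeEnergy.tendsto_div_floor`), `L^{-d} log Z_L` is eventually
within `K #planes (1 - ((m-1)/m)^d) + ε` of `m^{-d} log Z(A_m)` for every `m ≥ 1`, `ε > 0`; the
defect tends to `0` with `m`, so the sequence is Cauchy
(`FreeEnergy.exists_tendsto_of_eventually_abs_sub_le`) and converges.

The local notations `𝔅⟦n⟧` (box of plaquettes), `𝔴⟦p, U⟧`, `ℨ⟦A⟧`, `𝔱⟦p, U⟧` (weights and
free-boundary partition functions) are those of `PlaquetteWeightFreeEnergy`, redeclared; no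
definition is introduced.

## References

* S. Friedli, Y. Velenik, *Statistical Mechanics of Lattice Systems*, CUP 2017, Ch. 3, §3.2.2,
  Thm. 3.6 (existence of the pressure; any boundary condition). [FriedliVelenik2017]
* E. Seiler, LNP 159 (1982), Ch. 2 (thermodynamic functions of lattice gauge theories).
  [SeilerLNP1982]
-/

noncomputable section

open MeasureTheory Filter Topology Finset
open Literature.Probability.LatticeModels

namespace Literature.MathematicalPhysics.QuantumLattice

namespace PlaquetteWeightFreeEnergy

open FreeEnergy

variable {d : ℕ}

/-- The box of plaquettes of side `n`: base point in `[0, n)^d`, any plane (local notation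
`𝔅⟦n⟧` for `halfOpenBox d n ×ˢ univ`). [folklore] -/
local notation3 (prettyPrint := false) "𝔅⟦" n "⟧" =>
  (halfOpenBox d n ×ˢ Finset.univ : Finset (ZdPlaquette d))

variable {G : Type*} [Group G] [TopologicalSpace G] [IsTopologicalGroup G] [CompactSpace G]
  [MeasurableSpace G] [BorelSpace G] [SecondCountableTopology G] (v : G → ℝ)

/-- The weight `v(U_p)` of one plaquette of `ℤ^d` (local notation). [folklore] -/
local notation3 (prettyPrint := false) "𝔴⟦" p ", " U "⟧" =>
  v (plaquetteHolonomyZd U (Prod.fst p) (Prod.snd p).1.1 (Prod.snd p).1.2)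

/-- The free-boundary partition function `Z(A) = ∫ ∏_{p ∈ A} v(U_p) dg_∞` of a finite set of
plaquettes of `ℤ^d` (local notation). [folklore] -/
local notation3 (prettyPrint := false) "ℨ⟦" A "⟧" =>
  ∫ U, ∏ p ∈ A, 𝔴⟦p, U⟧ ∂QuantumFieldTheory.zdHaar d G

/-- The weight `v(U_p)` of one plaquette of the discrete torus (local notation). [folklore] -/
local notation3 (prettyPrint := false) "𝔱⟦" p ", " U "⟧" =>
  v (QuantumFieldTheory.plaquetteHolonomy U (Prod.fst p) (Prod.snd p).1.1 (Prod.snd p).1.2)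

/-- **The torus pressure of a continuous positive plaquette weight converges** (notation form of
`tendsto_torusPressure_of_continuous_pos`): `(L+1)^{-d} log Z_{L+1}(v)` converges as `L → ∞`, by
the sub-box estimate `abs_log_torusZ_sub_le` and the Cauchy criterion
`FreeEnergy.exists_tendsto_of_eventually_abs_sub_le`. [cite: FriedliVelenik2017, Ch. 3 §3.2.2, Thm. 3.6] -/
theorem exists_tendsto_log_torusZ (hv : Continuous v) (hpos : ∀ g, 0 < v g) :
    ∃ P, Tendsto (fun L : ℕ => (((L + 1 : ℕ) : ℝ) ^ d)⁻¹ *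
      Real.log (∫ U, ∏ p : QuantumFieldTheory.Plaquette d (L + 1), 𝔱⟦p, U⟧
        ∂(Measure.pi fun _ : QuantumFieldTheory.Edge d (L + 1) =>
          QuantumFieldTheory.haarProbability G))) atTop (𝓝 P) := by
  obtain ⟨K, hK⟩ := exists_exp_neg_le_le_exp hv hpos
  set D : ℕ := Fintype.card {q : Fin d × Fin d // q.1 < q.2} with hD
  -- the comparison constants `c_m = m^{-d} log Z(A_m)` and the defects `δ_m`
  set c : ℕ → ℝ := fun m => ((m : ℝ) ^ d)⁻¹ * Real.log ℨ⟦𝔅⟦m - 1⟧⟧ with hc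
  set δ : ℕ → ℝ := fun m => K * D * (1 - (1 / (m : ℝ)) ^ d * ((m - 1 : ℕ) : ℝ) ^ d) with hδ
  refine exists_tendsto_of_eventually_abs_sub_le (c := c) (δ := δ) ?_ ?_
  · -- `δ_m → 0`
    have h1 : Tendsto (fun m : ℕ => (1 / (m : ℝ)) * ((m - 1 : ℕ) : ℝ)) atTop (𝓝 1) := by
      have h : Tendsto (fun m : ℕ => (1 : ℝ) - 1 / (m : ℝ)) atTop (𝓝 (1 - 0)) :=
        tendsto_const_nhds.sub tendsto_one_div_atTop_nhds_zero_nat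
      rw [sub_zero] at h
      refine h.congr' ?_
      filter_upwards [eventually_ge_atTop 1] with m hm
      have hm0 : (m : ℝ) ≠ 0 := by exact_mod_cast (Nat.one_le_iff_ne_zero.1 hm)
      rw [Nat.cast_sub hm, Nat.cast_one]
      field_simp
    have h2 : Tendsto (fun m : ℕ => K * D * (1 - ((1 / (m : ℝ)) * ((m - 1 : ℕ) : ℝ)) ^ d))
        atTop (𝓝 (K * D * (1 - 1 ^ d))) :=
      (tendsto_const_nhds.sub (h1.pow d)).const_mul _
    rw [one_pow, sub_self, mul_zero] at h2
    refine h2.congr fun m => ?_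
    rw [hδ, mul_pow]
  · -- the sub-box estimate, divided by `(L+1)^d`
    filter_upwards [eventually_ge_atTop 1] with m hm ε hε
    set z : ℝ := ℨ⟦𝔅⟦m - 1⟧⟧ with hz
    set mm : ℝ := ((m - 1 : ℕ) : ℝ) ^ d with hmm
    set r : ℕ → ℝ := fun L => (((L + 1) / m : ℕ) : ℝ) / ((L + 1 : ℕ) : ℝ) with hr
    have hrt : Tendsto r atTop (𝓝 (1 / m)) := tendsto_div_floor m
    have hR : Tendsto
        (fun L => K * D * (1 - r L ^ d * mm) + |Real.log z| * |r L ^ d - (1 / (m : ℝ)) ^ d|)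
        atTop (𝓝 (K * D * (1 - (1 / (m : ℝ)) ^ d * mm) +
          |Real.log z| * |(1 / (m : ℝ)) ^ d - (1 / (m : ℝ)) ^ d|)) :=
      ((tendsto_const_nhds.sub ((hrt.pow d).mul_const mm)).const_mul _).add
        (((hrt.pow d).sub_const _).abs.const_mul _)
    rw [sub_self, abs_zero, mul_zero, add_zero] at hR
    have hev : ∀ᶠ L : ℕ in atTop,
        K * D * (1 - r L ^ d * mm) + |Real.log z| * |r L ^ d - (1 / (m : ℝ)) ^ d| < δ m + ε :=
      hR.eventually (Iio_mem_nhds (by rw [hδ]; linarith))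
    filter_upwards [hev] with L hL
    -- pointwise: `|b_L - c_m| ≤ K D (1 - r^d mm) + |log z| |r^d - m^{-d}|`
    have hE := abs_log_torusZ_sub_le (d := d) v hv hK (L + 1) m hm
    set s : ℝ := ((L + 1 : ℕ) : ℝ) ^ d with hs
    have hs0 : 0 < s := by positivity
    set X : ℝ := Real.log (∫ U, ∏ p : QuantumFieldTheory.Plaquette d (L + 1), 𝔱⟦p, U⟧
      ∂(Measure.pi fun _ : QuantumFieldTheory.Edge d (L + 1) =>
        QuantumFieldTheory.haarProbability G)) with hX
    set qd : ℝ := ((((L + 1) / m) ^ d : ℕ) : ℝ) with hqd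
    have hrd : r L ^ d = s⁻¹ * qd := by
      rw [hr, hqd, hs]
      simp only
      rw [div_pow, Nat.cast_pow]
      ring
    have hb : s⁻¹ * X - r L ^ d * Real.log z = s⁻¹ * (X - qd * Real.log z) := by
      rw [hrd]; ring
    have hstep1 : |s⁻¹ * X - r L ^ d * Real.log z| ≤ K * D * (1 - r L ^ d * mm) := by
      rw [hb, abs_mul, abs_of_pos (inv_pos.2 hs0)]
      calc s⁻¹ * |X - qd * Real.log z| ≤ s⁻¹ * (K * (D * (s - qd * mm))) :=
            mul_le_mul_of_nonneg_left hE (inv_pos.2 hs0).le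
        _ = K * D * (1 - r L ^ d * mm) := by
            rw [hrd]
            field_simp
    have hstep2 :
        |r L ^ d * Real.log z - c m| = |Real.log z| * |r L ^ d - (1 / (m : ℝ)) ^ d| := by
      rw [hc]
      simp only
      rw [← abs_mul, one_div, inv_pow]
      congr 1
      ring
    calc |s⁻¹ * X - c m| ≤ |s⁻¹ * X - r L ^ d * Real.log z| + |r L ^ d * Real.log z - c m| :=
          abs_sub_le _ _ _
      _ ≤ K * D * (1 - r L ^ d * mm) + |Real.log z| * |r L ^ d - (1 / (m : ℝ)) ^ d| := by
          rw [hstep2]; exact add_le_add hstep1 le_rfl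
      _ ≤ δ m + ε := hL.le

end PlaquetteWeightFreeEnergy

/-- **Thermodynamic limit of the torus pressure for a continuous positive plaquette weight**
(Friedli–Velenik 2017, Thm. 3.6, transcribed to the plaquette interaction on the discrete torus).
For a compact second-countable group `G` with a Borel σ-algebra, every dimension `d` and every
continuous `v : G → ℝ` with `0 < v`, the pressure
`(L+1)^{-d} log ∫ ∏_{q} v(U_q) d(⊗_{e} Haar)(U)` of the tori `(ℤ/(L+1)ℤ)^d` converges as `L → ∞`
(product over all plaquettes `q`, `U_q` = `QuantumFieldTheory.plaquetteHolonomy`; product of the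
Haar probability measures over the positively oriented edges). The Wilson weight
`v = exp(-β (N - Re tr ρ))` is `FreeEnergy.exists_tendsto_torusLogPartition`; the proof is the
same van Hove box-decomposition argument, which uses only `e^{-K} ≤ v ≤ e^{K}`
(`PlaquetteWeightFreeEnergy.abs_log_torusZ_sub_le`,
`PlaquetteWeightFreeEnergy.exists_tendsto_log_torusZ`).
[cite: FriedliVelenik2017, Ch. 3 §3.2.2, Thm. 3.6 (existence of the pressure, any boundary condition)] -/
theorem tendsto_torusPressure_of_continuous_pos {d : ℕ} {G : Type*} [Group G]
    [TopologicalSpace G] [IsTopologicalGroup G] [CompactSpace G] [MeasurableSpace G]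
    [BorelSpace G] [SecondCountableTopology G] {v : G → ℝ} (hv : Continuous v)
    (hpos : ∀ g, 0 < v g) :
    ∃ P : ℝ, Tendsto (fun L : ℕ => (((L + 1 : ℕ) : ℝ) ^ d)⁻¹ *
      Real.log (∫ U : QuantumFieldTheory.GaugeConfig d (L + 1) G,
        ∏ q : QuantumFieldTheory.Plaquette d (L + 1),
          v (QuantumFieldTheory.plaquetteHolonomy U q.1 q.2.1.1 q.2.1.2)
        ∂(Measure.pi fun _ : QuantumFieldTheory.Edge d (L + 1) =>
          QuantumFieldTheory.haarProbability G))) atTop (𝓝 P) :=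
  PlaquetteWeightFreeEnergy.exists_tendsto_log_torusZ v hv hpos

end Literature.MathematicalPhysics.QuantumLattice
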